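import Mathlib
import Summits.ValiantsHypothesis.ValiantsHypothesis.Theorems.BarrierLeverPartitionMinorsHitByVPHiddenStatesSymbolic

/-!
# Route BarrierLever — item `PartitionMinorsHitByVP` (stmt-ValiantsHypothesis-19717), line `hidden-states`:
# GENERIC GOODNESS IS MONOTONE UNDER SPECIALISATION OF FRAMES (splitting a piece can only help)

Helper file (`--supports stmt-ValiantsHypothesis-19717`; cell valiant-natproofs, rung V4, 𝒟-side door (c), registered line
`Cruxes/PartitionMinorsHitByVP/Lines/hidden_states.lean` v2, lane `stub_universalJoinWide`; prover seat val-np-p3 gen 10).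
Definition-free (imports `…HiddenStatesSymbolic`). Closes NO item.

THE POINT (memo val-np-p3 g10 §5, "Pascal peel is monotone"). If the hidden points of a column family `e` are obtained from those of
another family `e'` (same members-to-columns assignment, possibly MORE pieces) by an algebra endomorphism `Φ` of the symbolic table ring —
i.e. `e` is a SPECIALISATION of `e'` (frames merged, shifted, identified) — then `Φ (symDet u e') = symDet u e`, so generic goodness of the
special family forces generic goodness of the general one (`symDet_ne_zero_of_specialisation`). Instance: the Pascal peel
`B_t([n]) = B_t([n−1]) ⊔ B_{t−1}([n−1])` with two independent frames specialises to the one-piece ball by «frame₂ := frame₁ shifted by the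
state vector of `n−1`» (`Φ : X_{(p₂,none,a)} ↦ X_{(p₁,none,a)} + X_{(p₁,some q₀,a)}`, `X_{(p₂,some q,a)} ↦ X_{(p₁,some q,a)}`), so every
goodness result for single balls / ball–colex families transfers to their peeled versions, and the census monotonicity «peeled designs
never do worse» is a theorem, not an observation.

WHAT THIS IS NOT: no family is certified here; item 19717 OPEN; nothing on crux 14610 or VP ≠ VNP.
-/

set_option linter.dupNamespace false

namespace Summit.ValiantsHypothesis.ValiantsHypothesis.Theorems.BarrierLever.HiddenStates

open Finset Matrix MvPolynomial

noncomputable section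

namespace SymbJoin

variable {h m K r : ℕ}

/-- **Monotonicity under specialisation.** If an algebra endomorphism of the symbolic table ring maps the hidden points of `e'` to those of
`e` (column by column, coordinate by coordinate), then `symDet u e ≠ 0` implies `symDet u e' ≠ 0`. -/
theorem symDet_ne_zero_of_specialisation (u : Fin r → Finset (Fin h)) (e e' : Fin r → Fin m × Finset (Fin K))
    (Φ : MvPolynomial (Var m K h) ℂ →ₐ[ℂ] MvPolynomial (Var m K h) ℂ)
    (hΦ : ∀ k a, Φ (symPoint e' k a) = symPoint e k a) (hgood : symDet u e ≠ 0) : symDet u e' ≠ 0 := by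
  intro h0
  apply hgood
  have : Φ (symDet u e') = symDet u e := by
    rw [symDet, symDet, AlgHom.map_det]
    congr 1
    ext i k
    simp only [AlgHom.mapMatrix_apply, Matrix.map_apply, symMat, Matrix.of_apply, map_prod, hΦ]
  rw [← this, h0, map_zero]

/-- The same with a plain ring endomorphism (e.g. a substitution that also moves constants is not needed; stated for convenience). -/
theorem symDet_ne_zero_of_specialisation' (u : Fin r → Finset (Fin h)) (e e' : Fin r → Fin m × Finset (Fin K))
    (Φ : MvPolynomial (Var m K h) ℂ →+* MvPolynomial (Var m K h) ℂ)
    (hΦ : ∀ k a, Φ (symPoint e' k a) = symPoint e k a) (hgood : symDet u e ≠ 0) : symDet u e' ≠ 0 := by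
  intro h0
  apply hgood
  have : Φ (symDet u e') = symDet u e := by
    rw [symDet, symDet, RingHom.map_det]
    congr 1
    ext i k
    simp only [RingHom.mapMatrix_apply, Matrix.map_apply, symMat, Matrix.of_apply, map_prod, hΦ]
  rw [← this, h0, map_zero]

/-- **Frame merging.** The substitution that re-expresses piece `p₂` in the frame of piece `p₁` shifted by the state `q₀` of `p₁`:
`X_{(p₂,none,a)} ↦ X_{(p₁,none,a)} + X_{(p₁,some q₀,a)}`, `X_{(p₂,some q,a)} ↦ X_{(p₁,some q,a)}`, identity elsewhere. -/
def mergeSubst (p₁ p₂ : Fin m) (q₀ : Fin K) : MvPolynomial (Var m K h) ℂ →ₐ[ℂ] MvPolynomial (Var m K h) ℂ :=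
  MvPolynomial.aeval fun v : Var m K h =>
    if v.1 = p₂ then
      (match v.2.1 with
        | none => X (p₁, none, v.2.2) + X (p₁, some q₀, v.2.2)
        | some q => X (p₁, some q, v.2.2))
    else X v

/-- **Pascal peel is a specialisation.** Let column `k` of `e'` live in piece `p₂` with member `J` not containing `q₀`, and let the
corresponding column of `e` be `(p₁, insert q₀ J)`; columns of `e'` in pieces other than `p₂` are unchanged in `e`. Then `mergeSubst`
maps the hidden points of `e'` to those of `e`. (Apply with `e` = one-piece ball, `e'` = its peel, to transfer goodness to the peel.) -/
theorem mergeSubst_symPoint (p₁ p₂ : Fin m) (q₀ : Fin K) (e e' : Fin r → Fin m × Finset (Fin K))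
    (hsame : ∀ k, (e' k).1 ≠ p₂ → e k = e' k)
    (hmove : ∀ k, (e' k).1 = p₂ → q₀ ∉ (e' k).2 ∧ e k = (p₁, insert q₀ (e' k).2))
    (k : Fin r) (a : Fin h) : mergeSubst p₁ p₂ q₀ (symPoint e' k a) = symPoint e k a := by
  classical
  by_cases hk : (e' k).1 = p₂
  · obtain ⟨hq₀, hek⟩ := hmove k hk
    rw [symPoint, symPoint, hek, map_add, map_sum]
    simp only [mergeSubst, MvPolynomial.aeval_X, hk, if_true]
    rw [Finset.sum_insert hq₀]
    ring
  · rw [symPoint, symPoint, hsame k hk, map_add, map_sum]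
    simp only [mergeSubst, MvPolynomial.aeval_X, hk, if_false]

end SymbJoin

end

end Summit.ValiantsHypothesis.ValiantsHypothesis.Theorems.BarrierLever.HiddenStates
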